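import Summits.ResolutionOfSingularities.ResolutionOfSingularities.Theorems.MarkedTransferCampaignW21CaseIII
import HarnessLib

/-!
# [OURS · L1 W2.1] The Case-(III) order bound for EVERY exponent `e` (`OrderBoundCaseIII p`, v4 name) — PROVED for
# every prime `p`; hence the all-`e` by-case bound `OrderBoundOpOn p MinDegreeTop`

Rung L (rescue) of cell res-hironaka, RESCUE-SEED row L-G2, slot W2.1, seat res-L1-k21 (kill test K2.1). The v4 vocabulary
(`MarkedTransferCampaignW21OrderBoundInClass.lean`, p465799/p469920) states the Case-(III) bound `OrderBoundCaseIII p` over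
ALL `e : ℕ`; its erratum note (v5) says «the `e = 0` slice is outside the printed range and not vouched for; the CANDIDATE of
record is `OrderBoundCaseIIIPos p`». The `e > 0` candidate is proved in `MarkedTransferCampaignW21CaseIII.lean`
(`orderBoundCaseIIIPos_holds`, res-L1-k21). THIS FILE settles the v4 name as typed — unlike its six Case-(I) siblings
(refuted at `e = 0`, `MarkedTransferCampaignW21OrderBoundInClassRefutation.lean`), `OrderBoundCaseIII p` is TRUE for
every `e`:

* `order_le_order_iterate_pre_of_degree_add_le` — ELEMENTARY ITERATION BOUND (any exponents, any commutative setting of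
  the file: `K⟦x₁…xₙ⟧`): if `|α+pβ| + |qγ₀| ≤ ord ε` then `ord ε ≤ ord (h♭)^k(ε)` for every `k`, `h♭(F) = ∂^{(α+pβ)}F ·
  ∂^{(qγ₀)}F` (row 057 `HFlat.pre` at `∂ = hasseD`), from `ord ∂^{(X)}F ≥ ord F − |X|` alone;
* `orderBoundCaseIII_holds : OrderBoundCaseIII p` — at `e = 0` Case (III) reads `|α+pβ| = |γ₀| = 1` and `Standing.ord_lt`
  reads `1 < ord ε`, so `|α+pβ| + |qγ₀| = 2 ≤ ord ε` and the elementary bound applies; at `e > 0` it is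
  `orderBoundCaseIIIPos_holds`;
* `orderBoundOpOn_minDegreeTop_holds : OrderBoundOpOn p MinDegreeTop` — the v4 (all-`e`) Def. 9.12-shaped bound «in all
  three cases» on the class `MinDegreeTop` (`OrderBoundMinDegreeTop p` res-L1-k21 p463892, `OrderBoundCaseII p`
  res-L1-s21-pv-1 p473059, `OrderBoundCaseIII p` here), by cases on the witness `HFlat.Case`.

Everything here is OURS / folklore; nothing is a statement of or about the manuscript under adjudication (GAP row R05);
the manuscript's own range is `e > 0` (p.48 L25–L26). AI-produced formalisation; expert review is stronger than AI review.

## References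
* N. Bourbaki, *Algèbre commutative* III §4 no. 5 (21) [Bourbaki1989CommAlg] — divided derivatives; `ord Δ_α f ≥ ord f − |α|`
  is the tree's `order_le_order_hasseDeriv_add_degree`.
* H. Hironaka, ms. 2017-03-23: Lem. 9.6 p.50 L21–L25; Rem. 9.11 p.51 L16–L29 — scope only, under adjudication. [Hironaka2017]
-/

noncomputable section

set_option linter.dupNamespace false -- mandated namespace of this single-conjunct summit

namespace Summit.ResolutionOfSingularities.ResolutionOfSingularities.Theorems

namespace CampaignW21

open Literature.AlgebraicGeometry.Hironaka2017.S08UnitMonomial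
open Literature.AlgebraicGeometry.Hironaka2017.S09LLUED
open Literature.AlgebraicGeometry.Hironaka2017.S09LLUED.TopFrontier
open Literature.AlgebraicGeometry.Resolution
open Literature.RingTheory.MvPowerSeries
open MvPowerSeries Finsupp

/-- `ℕ∞` bookkeeping: `o ≤ a + dX`, `o ≤ b + dG`, `dX + dG ≤ o` give `o ≤ a + b`. [folklore] -/
theorem enat_le_add_of_le_add_of_le_add {o a b : ℕ∞} {dX dG : ℕ} (h1 : o ≤ a + dX) (h2 : o ≤ b + dG)
    (h3 : ((dX + dG : ℕ) : ℕ∞) ≤ o) : o ≤ a + b := by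
  induction a using ENat.recTopCoe with
  | top => simp
  | coe a =>
    induction b using ENat.recTopCoe with
    | top => simp
    | coe b =>
      induction o using ENat.recTopCoe with
      | top =>
        exfalso
        rw [← ENat.coe_add, top_le_iff] at h1
        exact ENat.coe_ne_top _ h1
      | coe o =>
        norm_cast at h1 h2 h3 ⊢
        omega

/-- **ELEMENTARY ITERATION BOUND**: if `|α+pβ| + |qγ₀| ≤ ord ε` then `ord ε ≤ ord (h♭)^k(ε)` for every `k`, where
`h♭(F) = ∂^{(α+pβ)}F · ∂^{(qγ₀)}F` is row 057's `HFlat.pre` at `∂ = hasseD` on `K⟦x₁…xₙ⟧`: each factor loses at most the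
degree of its multi-index (`order_le_order_hasseDeriv_add_degree`), so `ord ε_{k+1} ≥ 2·ord ε_k − (|α+pβ| + |qγ₀|) ≥
ord ε_k`. No structure of `ε` is used. [folklore] -/
theorem order_le_order_iterate_pre_of_degree_add_le {K : Type} [Field K] {n : ℕ} (p q : ℕ) (α β γ₀ : Fin n →₀ ℕ)
    (ε : MvPowerSeries (Fin n) K)
    (hdeg : (((α + p • β).degree + (q • γ₀).degree : ℕ) : ℕ∞) ≤ ε.order) (k : ℕ) :
    ε.order ≤ ((HFlat.pre (hasseD K n) p q α β γ₀)^[k] ε).order := by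
  induction k with
  | zero => rw [Function.iterate_zero, id]
  | succ k ih =>
    rw [Function.iterate_succ_apply']
    set F := (HFlat.pre (hasseD K n) p q α β γ₀)^[k] ε with hF
    show ε.order ≤ (hasseDeriv (α + p • β) F * hasseDeriv (q • γ₀) F).order
    have h1 := Literature.RingTheory.MvPowerSeries.order_le_order_hasseDeriv_add_degree (α + p • β) F
    have h2 := Literature.RingTheory.MvPowerSeries.order_le_order_hasseDeriv_add_degree (q • γ₀) F
    exact ih.trans ((enat_le_add_of_le_add_of_le_add h1 h2 (hdeg.trans ih)).trans MvPowerSeries.le_order_mul)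

/-- **[OURS · L1 W2.1] `OrderBoundCaseIII p` (v4 name, ALL `e`) HOLDS for every prime `p`**: under `Standing` and Case
(III) of Lem. 9.6 (row 056), `ord ε ≤ ord H♭_{III}(ε)`, `H♭_{III} = HFlat.caseIII = (h♭)^{k̄}` at `∂ = hasseD`, in
`K⟦x₁…xₙ⟧`. For `e > 0` this is `orderBoundCaseIIIPos_holds`; at `e = 0` (outside the manuscript's range, but admitted
by the v4 binder) Case (III) forces `|α+pβ| = |γ₀| = 1` while `Standing.ord_lt` gives `1 < ord ε`, so the elementary
iteration bound applies. Replaces the role of Rem. 9.11 (8) p.51 L28–L29, first clause; NOT a statement of the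
manuscript. [folklore] -/
theorem orderBoundCaseIII_holds (p : ℕ) [hp : Fact p.Prime] : OrderBoundCaseIII p := by
  intro K _ _ n e ℓ ε S h0 hS hIII
  rcases Nat.eq_zero_or_pos e with he | he
  · subst he
    obtain ⟨-, hle, hq, -⟩ := hIII
    have hdeg : (((alpha S.support S.u + p • beta S.support S.u).degree +
        (p ^ 0 • gamma S.support S.u ⟨0, h0⟩).degree : ℕ) : ℕ∞) ≤ ε.order := by
      have hlt : ((p ^ 0 : ℕ) : ℕ∞) < ε.order := by rw [← adicOrder_eq_order]; exact hS.ord_lt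
      have h2 : (alpha S.support S.u + p • beta S.support S.u).degree +
          (p ^ 0 • gamma S.support S.u ⟨0, h0⟩).degree ≤ p ^ 0 + 1 := by
        rw [hq] at hle ⊢; rw [pow_zero] at hle ⊢; omega
      have hlt' : ((p ^ 0 : ℕ) : ℕ∞) + 1 ≤ ε.order := Order.add_one_le_of_lt hlt
      refine le_trans ?_ hlt'
      exact_mod_cast h2
    show adicOrder ε ≤ adicOrder ((HFlat.pre (hasseD K n) p (p ^ 0) (alpha S.support S.u) (beta S.support S.u)
      (gamma S.support S.u ⟨0, h0⟩))^[HFlat.kBar (p ^ 0) (HFlat.bAIII p (p ^ 0) (alpha S.support S.u)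
        (beta S.support S.u) (gamma S.support S.u ⟨0, h0⟩))] ε)
    rw [adicOrder_eq_order, adicOrder_eq_order]
    exact order_le_order_iterate_pre_of_degree_add_le p (p ^ 0) _ _ _ ε hdeg _
  · exact orderBoundCaseIIIPos_holds p K n e ℓ he ε S h0 hS hIII

/-- **[OURS · L1 W2.1] `OrderBoundOpOn p MinDegreeTop` (v4, ALL `e`) HOLDS for every prime `p`**: the Def. 9.12-shaped order
clause «in all three cases of Lem.(9.6)» (p.51 L30–L31) over `HFlat.op`, on the class `MinDegreeTop` (K2.1's `C_A`, R05's
named `P`) — Case (I) `orderBoundMinDegreeTop_holds` (res-L1-k21 p463892, all `e`), Case (II) `orderBoundCaseII_holds`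
(res-L1-s21-pv-1 p473059, all `e`), Case (III) `orderBoundCaseIII_holds` (all `e`). NOT a statement of the manuscript.
[folklore] -/
theorem orderBoundOpOn_minDegreeTop_holds (p : ℕ) [Fact p.Prime] : OrderBoundOpOn p MinDegreeTop := by
  intro K _ _ n e ℓ ε S h0 hS c hC
  cases c with
  | I h => exact orderBoundMinDegreeTop_holds p K n e ℓ ε S h0 hS h hC
  | II h => exact orderBoundCaseII_holds p K n e ℓ ε S h0 hS h
  | III h => exact orderBoundCaseIII_holds p K n e ℓ ε S h0 hS h

end CampaignW21

end Summit.ResolutionOfSingularities.ResolutionOfSingularities.Theorems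

end
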